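import Literature.Probability.RandomPlanarGeometry.HexSAW
import Mathlib.Data.Set.Finite.List
import HarnessLib

/-!
# Self-avoiding walks with edge-dependent fugacities: weight, law, and law of the drawn curve

Topic `Literature/Probability/RandomPlanarGeometry`; definition request `defn-edgeFugacityLaw`
(route `CriticalPhenomena/SAWScalingLimit/SAWCompassLattice`, items `CompassSLE`,
`SurfaceUniversality`, which so far write these objects inline). The carrier in print is the
WEIGHTED self-avoiding walk of G. R. Grimmett, Z. Li, *Weighted self-avoiding walks*, J. Algebraic
Combin. 52 (2019) 77–102 (arXiv:1804.05380), §2, verbatim (arXiv p. 5): "We weight the edges of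
`G` via a function `φ : E → (0, ∞)` […] An `n`-step self-avoiding walk (SAW) on `G` is an ordered
sequence `π = (π₀, π₁, …, πₙ)` of distinct vertices of `G` such that `eᵢ = ⟨π_{i-1}, πᵢ⟩ ∈ E` for
`1 ≤ i ≤ n`. The weight of `π` is the product (2.2) `w(π) := ∏_{i=1}^n φ(⟨π_{i-1}, πᵢ⟩)`. […] For
a set `Π` of SAWs, we write `w(Π) = Σ_{π ∈ Π} w(π)`", generalising the single fugacity `x^{#edges}`
(Duminil-Copin–Smirnov's `P_{x,δ}`, tree: `embWeight`/`embLaw` of `HexSAW.lean`, which use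
`x^{#vertices}`). This file (namespace `Literature.Probability.RandomPlanarGeometry.SAW`, next to
the generic layer of `HexSAW.lean`) provides, for a graph `G` on `V`, a weight `y : V → V → ℝ` on
ordered pairs (the route's `y d.fst d.snd` on darts; Grimmett–Li's `φ` is the symmetric case), a
vertex restriction `S : Set V` (the route's `S Ω δ`), endpoints `a b : V`, an embedding
`emb : V → ℂ` and a mesh `δ : ℝ`:

* `dartWeight G y p = (p.darts.map fun d ↦ y d.fst d.snd).prod` — the weight (2.2) of a walk
  (`dartWeight_cons`, `dartWeight_const : = x ^ p.length`, `dartWeight_reverse`, positivity);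
* `RestrictedSAW G S a b = {p : G.Walk a b // p.IsPath ∧ ∀ v ∈ p.support, v ∈ S}` — the SAWs of `G`
  from `a` to `b` through vertices of `S` (the index type of the route's `Measure.sum`), with the
  discrete σ-algebra, finite when `S` is (`RestrictedSAW.finite`), `RestrictedSAW.curve emb δ`
  (the `δ`-scaled polyline through `emb`, as `EmbDomainSAW.curve`);
* `edgeFugacityWeight G y S a b` — the measure `Σ_γ w(γ) δ_γ` on `RestrictedSAW G S a b`
  (`w(Π)` of the quote) and **`edgeFugacityLaw G y S a b`**, its normalisation (junk `0` if the
  total weight is `0` or `∞`, exactly as `embLaw`);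
* `edgeFugacityCurveWeight G emb y S δ a b = Σ_γ w(γ) δ_{curve γ}` and
  **`edgeFugacityCurveLaw G emb y S δ a b`** — the same pushed to `CurveClass ℂ`, written as the
  route items write it (`Measure.sum fun p ↦ ofReal (wt p) • dirac (CurveClass.mk ⟨p.1.toCurve …⟩)`
  normalised by its total mass); `edgeFugacityCurveWeight_eq_map` / `edgeFugacityCurveLaw_eq_map`
  identify them with the push-forwards of the path-level measures along `RestrictedSAW.curve`.

API (all proved): singleton masses, total mass as a `tsum`, finiteness of the total mass for
finite `S` and its positivity when some SAW has positive weight (`edgeFugacityWeight_univ_ne_zero`),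
whence `IsProbabilityMeasure` (`isProbabilityMeasure_edgeFugacityLaw[_of_finite]`); and the
**single-fugacity specialisation**: on `G = embDomainGraph G₀ emb Ω δ`, `S = univ`, `y ≡ x`,
the equivalence `EmbDomainSAW.equivRestrictedSAW` with `RestrictedSAW … univ a b` carries
`embWeight G₀ emb Ω δ x a b` to `ofReal x • edgeFugacityWeight …` (`x ≥ 0`: `x^{ℓ(γ)} = x · x^{#edges}`,
`map_embWeight_eq`) and `embLaw` to `edgeFugacityLaw` (`x > 0`, the factor cancelling:
`map_embLaw_eq`).

Not here: invariance under weight-preserving graph automorphisms (Grimmett–Li's `ℋ`-invariance,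
§2) and the weighted connective constant `μ(G, φ)` (their Thm. 2) — not needed to STATE the route
items; Mathlib has no weighted SAW (`lean search 'fugacity'`, `'dartWeight'`: nothing).

## References

* [GrimmettLi2019] G. R. Grimmett, Z. Li, Weighted self-avoiding walks, J. Algebraic Combin. 52
  (2019) 77–102, §2, (2.2).
* [DuminilCopinSmirnov2012] H. Duminil-Copin, S. Smirnov, Ann. of Math. 175 (2012), §4 (the law
  `P_{x,δ}`), for the single-fugacity case.
-/

noncomputable section

open MeasureTheory SimpleGraph
open scoped ENNReal

namespace Literature.Probability.RandomPlanarGeometry.SAW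

variable {V : Type*} (G : SimpleGraph V)

/-! ### The weight of a walk -/

/-- **The weight of a walk for the pair fugacity `y`**: the product over its darts `(u, v)` of
`y u v` — Grimmett–Li (2.2), `w(π) = ∏ᵢ φ(⟨π_{i-1}, πᵢ⟩)`, with `φ` allowed to depend on the
orientation (it does not in the sources; `dartWeight_reverse`). [cite: GrimmettLi2019, §2, (2.2)] -/
def dartWeight (y : V → V → ℝ) {u v : V} (p : G.Walk u v) : ℝ :=
  (p.darts.map fun d ↦ y d.fst d.snd).prod

variable {G}

/-- The trivial walk has weight `1` (empty product). [cite: GrimmettLi2019, §2, (2.2)] -/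
@[simp] theorem dartWeight_nil (y : V → V → ℝ) (u : V) :
    dartWeight G y (Walk.nil : G.Walk u u) = 1 := by
  simp [dartWeight]

/-- `w(u → v → ⋯) = y u v · w(v → ⋯)`. [cite: GrimmettLi2019, §2, (2.2)] -/
@[simp] theorem dartWeight_cons (y : V → V → ℝ) {u v w : V} (h : G.Adj u v) (p : G.Walk v w) :
    dartWeight G y (Walk.cons h p) = y u v * dartWeight G y p := by
  simp [dartWeight]

/-- Weights multiply under concatenation. [cite: GrimmettLi2019, §2, (2.2)] -/
theorem dartWeight_append (y : V → V → ℝ) {u v w : V} (p : G.Walk u v) (q : G.Walk v w) :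
    dartWeight G y (p.append q) = dartWeight G y p * dartWeight G y q := by
  simp [dartWeight, Walk.darts_append]

/-- **Single fugacity**: for the constant weight `y ≡ x`, `w(π) = x^{#edges of π}`
(Duminil-Copin–Smirnov's `x^{|γ|}` with `|γ|` the number of steps). [cite: GrimmettLi2019, §2, (2.2)] -/
theorem dartWeight_const (x : ℝ) {u v : V} (p : G.Walk u v) :
    dartWeight G (fun _ _ ↦ x) p = x ^ p.length := by
  simp [dartWeight, List.prod_replicate, Walk.length_darts]

/-- Reversing a walk replaces `y` by its transpose; in particular the weight of a SAW for a
SYMMETRIC `y` "is the same irrespective of the direction in which it is traversed" (Grimmett–Li,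
after (2.2)). [cite: GrimmettLi2019, §2, after (2.2)] -/
theorem dartWeight_reverse (y : V → V → ℝ) {u v : V} (p : G.Walk u v) :
    dartWeight G y p.reverse = dartWeight G (fun a b ↦ y b a) p := by
  simp only [dartWeight, Walk.darts_reverse, List.map_reverse, List.prod_reverse, List.map_map]
  rfl

/-- The weight of a walk all of whose darts have nonnegative weight is nonnegative. [folklore] -/
theorem dartWeight_nonneg {y : V → V → ℝ} (hy : ∀ a b, G.Adj a b → 0 ≤ y a b) {u v : V}
    (p : G.Walk u v) : 0 ≤ dartWeight G y p := by
  unfold dartWeight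
  refine List.prod_nonneg fun t ht ↦ ?_
  obtain ⟨d, -, rfl⟩ := List.mem_map.1 ht
  exact hy _ _ d.adj

/-- The weight of a walk all of whose darts have positive weight is positive (Grimmett–Li:
`φ : E → (0, ∞)`). [cite: GrimmettLi2019, §2] -/
theorem dartWeight_pos {y : V → V → ℝ} (hy : ∀ a b, G.Adj a b → 0 < y a b) {u v : V}
    (p : G.Walk u v) : 0 < dartWeight G y p := by
  unfold dartWeight
  refine List.prod_pos fun t ht ↦ ?_
  obtain ⟨d, -, rfl⟩ := List.mem_map.1 ht
  exact hy _ _ d.adj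

/-! ### Self-avoiding walks through a vertex set -/

variable (G) in
/-- **The self-avoiding walks of `G` from `a` to `b` through vertices of `S`**: walks visiting no
vertex twice ("an ordered sequence of distinct vertices") all of whose vertices lie in `S` (the
discrete domain, e.g. the route's `S Ω δ`). The index type of the sums `w(Π) = Σ_{π ∈ Π} w(π)`.
[cite: GrimmettLi2019, §2] -/
def RestrictedSAW (S : Set V) (a b : V) : Type _ :=
  {p : G.Walk a b // p.IsPath ∧ ∀ v ∈ p.support, v ∈ S}

namespace RestrictedSAW

variable {S : Set V} {a b : V}

/-- Discrete σ-algebra on the set of SAWs (as for `EmbDomainSAW`). [folklore] -/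
instance : MeasurableSpace (RestrictedSAW G S a b) := ⊤

/-- The discrete σ-algebra is registered as such. [folklore] -/
instance : DiscreteMeasurableSpace (RestrictedSAW G S a b) := ⟨fun _ ↦ trivial⟩

/-- The underlying walk. [cite: GrimmettLi2019, §2] -/
abbrev walk (γ : RestrictedSAW G S a b) : G.Walk a b := γ.1

/-- The underlying walk is self-avoiding. [cite: GrimmettLi2019, §2] -/
theorem isPath (γ : RestrictedSAW G S a b) : γ.walk.IsPath := γ.2.1

/-- The vertices of the walk lie in `S`. [cite: GrimmettLi2019, §2] -/
theorem support_subset (γ : RestrictedSAW G S a b) : ∀ v ∈ γ.walk.support, v ∈ S := γ.2.2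

/-- Two restricted SAWs with the same walk are equal. [folklore] -/
@[ext] theorem ext {γ γ' : RestrictedSAW G S a b} (h : γ.walk = γ'.walk) : γ = γ' :=
  Subtype.ext h

/-- The trivial SAW at a vertex of `S`. [folklore] -/
def nil (ha : a ∈ S) : RestrictedSAW G S a a :=
  ⟨Walk.nil, Walk.IsPath.nil, fun v hv ↦ by
    rw [Walk.support_nil, List.mem_singleton] at hv
    exact hv ▸ ha⟩

/-- The trivial SAW has the trivial walk. [folklore] -/
@[simp] theorem walk_nil (ha : a ∈ S) : (nil ha : RestrictedSAW G S a a).walk = Walk.nil := rfl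

/-- The space of SAWs from `a ∈ S` to itself is nonempty. [folklore] -/
theorem nonempty_of_mem (ha : a ∈ S) : Nonempty (RestrictedSAW G S a a) := ⟨nil ha⟩

/-- **A finite vertex set carries finitely many SAWs** between two given vertices: a SAW is
determined by its support (`Walk.ext_support`), a list of distinct elements of `S`.
[cite: GrimmettLi2019, §2] -/
instance finite [Finite S] : Finite (RestrictedSAW G S a b) := by
  classical
  letI : Fintype S := Fintype.ofFinite S
  -- a SAW ↦ its support, as a duplicate-free list of elements of `S`
  let φ : RestrictedSAW G S a b → List S := fun γ ↦
    γ.walk.support.pmap (fun v hv ↦ ⟨v, hv⟩) γ.support_subset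
  have hφval : ∀ γ, (φ γ).map Subtype.val = γ.walk.support := by
    intro γ
    simp only [φ, List.map_pmap, List.pmap_eq_map, List.map_id']
  have hφinj : Function.Injective φ := by
    intro γ γ' h
    have := congrArg (List.map Subtype.val) h
    rw [hφval, hφval] at this
    exact ext (Walk.ext_support this)
  have hφlen : ∀ γ, (φ γ).length ≤ Fintype.card S := by
    intro γ
    refine List.Nodup.length_le_card ?_
    exact (γ.isPath.support_nodup).pmap (by intro _ _ _ _ h; exact congrArg Subtype.val h)
  haveI : Finite {l : List S // l.length ≤ Fintype.card S} :=
    (List.finite_length_le S (Fintype.card S)).to_subtype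
  exact Finite.of_injective (fun γ ↦ (⟨φ γ, hφlen γ⟩ : {l : List S // l.length ≤ Fintype.card S}))
    fun γ γ' h ↦ hφinj (congrArg Subtype.val h)

/-- The SAW drawn as a curve at mesh `δ`: the polyline through the rescaled embedded vertices
`δ emb π₀, …, δ emb πₙ`, modulo reparametrisation (as `EmbDomainSAW.curve`; the route's
`CurveClass.mk ⟨p.1.toCurve …⟩`). [cite: DuminilCopinSmirnov2012, §4 (before Conjecture 1)] -/
def curve (emb : V → ℂ) (δ : ℝ) (γ : RestrictedSAW G S a b) : CurveClass ℂ :=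
  CurveClass.mk ⟨γ.walk.toCurve fun v ↦ (δ : ℂ) * emb v⟩

/-- Every map out of the space of SAWs is measurable (discrete σ-algebra). [folklore] -/
theorem measurable_of_top {β : Type*} [MeasurableSpace β] (f : RestrictedSAW G S a b → β) :
    Measurable f :=
  fun _ _ ↦ MeasurableSpace.measurableSet_top

end RestrictedSAW

/-! ### The weighted SAW measure and its law -/

variable (G)

/-- **The weighted SAW measure** on SAWs of `G` through `S` from `a` to `b` for the pair fugacity
`y`: `γ` gets mass `w(γ)` (`dartWeight`), i.e. `Σ_γ w(γ) δ_γ`, so that a set `Π` of SAWs has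
measure `w(Π) = Σ_{π ∈ Π} w(π)` (Grimmett–Li); negative weights are truncated to `0` by
`ENNReal.ofReal` (junk, as in `embWeight`). [cite: GrimmettLi2019, §2, (2.2) and w(Π)] -/
def edgeFugacityWeight (y : V → V → ℝ) (S : Set V) (a b : V) : Measure (RestrictedSAW G S a b) :=
  Measure.sum fun γ ↦ ENNReal.ofReal (dartWeight G y γ.walk) • Measure.dirac γ

/-- **The law of the weighted SAW** (`edgeFugacityLaw`): the weighted SAW measure normalised by its
total mass — `γ` has probability `w(γ)/w(Π)`, `Π` the SAWs of `G` through `S` from `a` to `b`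
(the edge-fugacity generalisation of Duminil-Copin–Smirnov's `P_{x,δ}` = `embLaw`); junk value
`0` when the total weight is `0` or `∞`. [cite: GrimmettLi2019, §2, (2.2) and w(Π)]
[cite: DuminilCopinSmirnov2012, §4 (before Conjecture 1)] -/
def edgeFugacityLaw (y : V → V → ℝ) (S : Set V) (a b : V) : Measure (RestrictedSAW G S a b) :=
  (edgeFugacityWeight G y S a b Set.univ)⁻¹ • edgeFugacityWeight G y S a b

/-- **The weighted SAW measure on drawn curves**: `Σ_γ w(γ) δ_{curve γ}` on `CurveClass ℂ`, the
curve of `γ` being its `δ`-scaled polyline through `emb` — written exactly as the route items of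
`SAWCompassLattice` write it; equal to the push-forward of `edgeFugacityWeight` along
`RestrictedSAW.curve` (`edgeFugacityCurveWeight_eq_map`). [cite: GrimmettLi2019, §2, (2.2) and w(Π)]
[cite: DuminilCopinSmirnov2012, §4 (before Conjecture 1)] -/
def edgeFugacityCurveWeight (emb : V → ℂ) (y : V → V → ℝ) (S : Set V) (δ : ℝ) (a b : V) :
    Measure (CurveClass ℂ) :=
  Measure.sum fun γ : RestrictedSAW G S a b ↦
    ENNReal.ofReal (dartWeight G y γ.walk) • Measure.dirac (γ.curve emb δ)

/-- **The law of the drawn weighted SAW** as a random element of `CurveClass ℂ`: the curve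
measure normalised by its total mass (`= edgeFugacityLaw` pushed forward along
`RestrictedSAW.curve`, `edgeFugacityCurveLaw_eq_map`). [cite: GrimmettLi2019, §2, (2.2) and w(Π)]
[cite: DuminilCopinSmirnov2012, §4 (before Conjecture 1)] -/
def edgeFugacityCurveLaw (emb : V → ℂ) (y : V → V → ℝ) (S : Set V) (δ : ℝ) (a b : V) :
    Measure (CurveClass ℂ) :=
  (edgeFugacityCurveWeight G emb y S δ a b Set.univ)⁻¹ • edgeFugacityCurveWeight G emb y S δ a b

variable {G} {y : V → V → ℝ} {S : Set V} {a b : V}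

/-- The mass of a single SAW is its weight `w(γ)`. [cite: GrimmettLi2019, §2, (2.2)] -/
theorem edgeFugacityWeight_singleton (y : V → V → ℝ) (γ : RestrictedSAW G S a b) :
    edgeFugacityWeight G y S a b {γ} = ENNReal.ofReal (dartWeight G y γ.walk) := by
  rw [edgeFugacityWeight, Measure.sum_apply _ MeasurableSpace.measurableSet_top, tsum_eq_single γ]
  · simp
  · intro γ' hγ'
    simp [hγ']

/-- `w(Π) = Σ_{π ∈ Π} w(π)`: the measure of a set of SAWs is the sum of their weights.
[cite: GrimmettLi2019, §2, w(Π)] -/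
theorem edgeFugacityWeight_apply (y : V → V → ℝ) (A : Set (RestrictedSAW G S a b)) :
    edgeFugacityWeight G y S a b A =
      ∑' γ : RestrictedSAW G S a b, A.indicator (fun γ ↦ ENNReal.ofReal (dartWeight G y γ.walk)) γ := by
  classical
  rw [edgeFugacityWeight, Measure.sum_apply _ MeasurableSpace.measurableSet_top]
  refine tsum_congr fun γ ↦ ?_
  by_cases hγ : γ ∈ A <;> simp [hγ, Set.indicator]

/-- The total weight `w(Π)` of all SAWs through `S` from `a` to `b`. [cite: GrimmettLi2019, §2, w(Π)] -/
theorem edgeFugacityWeight_univ (y : V → V → ℝ) :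
    edgeFugacityWeight G y S a b Set.univ =
      ∑' γ : RestrictedSAW G S a b, ENNReal.ofReal (dartWeight G y γ.walk) := by
  simp [edgeFugacityWeight_apply]

/-- **Finiteness**: for a finite vertex set `S` the total weight is finite (finitely many SAWs,
`RestrictedSAW.finite`, each of finite mass). [cite: GrimmettLi2019, §2] -/
theorem edgeFugacityWeight_univ_lt_top [Finite S] (y : V → V → ℝ) :
    edgeFugacityWeight G y S a b Set.univ < ∞ := by
  letI : Fintype (RestrictedSAW G S a b) := Fintype.ofFinite _
  rw [edgeFugacityWeight_univ, tsum_fintype]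
  exact ENNReal.sum_lt_top.2 fun γ _ ↦ ENNReal.ofReal_lt_top

/-- **Positivity**: if some SAW through `S` from `a` to `b` has positive weight (e.g. any SAW when
`y > 0` on edges, `dartWeight_pos`), the total weight is nonzero. [cite: GrimmettLi2019, §2] -/
theorem edgeFugacityWeight_univ_ne_zero (γ : RestrictedSAW G S a b)
    (hγ : 0 < dartWeight G y γ.walk) : edgeFugacityWeight G y S a b Set.univ ≠ 0 := by
  intro h0
  have hle : edgeFugacityWeight G y S a b {γ} ≤ edgeFugacityWeight G y S a b Set.univ :=
    measure_mono (Set.subset_univ _)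
  rw [h0, edgeFugacityWeight_singleton, nonpos_iff_eq_zero, ENNReal.ofReal_eq_zero] at hle
  exact absurd hle (not_le.2 hγ)

/-- The law is a probability measure as soon as the total weight is neither `0` nor `∞`.
[cite: GrimmettLi2019, §2] -/
theorem isProbabilityMeasure_edgeFugacityLaw (h0 : edgeFugacityWeight G y S a b Set.univ ≠ 0)
    (hfin : edgeFugacityWeight G y S a b Set.univ ≠ ∞) :
    IsProbabilityMeasure (edgeFugacityLaw G y S a b) :=
  ⟨by rw [edgeFugacityLaw, Measure.smul_apply, smul_eq_mul, ENNReal.inv_mul_cancel h0 hfin]⟩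

/-- **The law is a probability measure for a finite vertex set containing a SAW of positive
weight** (the situation of a finite discrete domain `Ω_δ` with positive fugacities).
[cite: GrimmettLi2019, §2] -/
theorem isProbabilityMeasure_edgeFugacityLaw_of_finite [Finite S] (γ : RestrictedSAW G S a b)
    (hγ : 0 < dartWeight G y γ.walk) : IsProbabilityMeasure (edgeFugacityLaw G y S a b) :=
  isProbabilityMeasure_edgeFugacityLaw (edgeFugacityWeight_univ_ne_zero γ hγ)
    (edgeFugacityWeight_univ_lt_top y).ne

/-! ### The curve measures are push-forwards -/

/-- **The curve measure is the push-forward of the SAW measure along `curve`.** (Push-forward of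
a sum of weighted Dirac masses under a measurable map.) [folklore] -/
theorem edgeFugacityCurveWeight_eq_map (emb : V → ℂ) (y : V → V → ℝ) (δ : ℝ) :
    edgeFugacityCurveWeight G emb y S δ a b =
      (edgeFugacityWeight G y S a b).map (RestrictedSAW.curve emb δ) := by
  have hm : Measurable (RestrictedSAW.curve (G := G) (S := S) (a := a) (b := b) emb δ) :=
    RestrictedSAW.measurable_of_top _
  ext A hA
  rw [Measure.map_apply hm hA, edgeFugacityCurveWeight, Measure.sum_apply _ hA,
    edgeFugacityWeight, Measure.sum_apply _ (hm hA)]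
  refine tsum_congr fun γ ↦ ?_
  classical
  simp only [Measure.smul_apply, smul_eq_mul, Measure.dirac_apply' _ hA,
    Measure.dirac_apply' _ (hm hA), Set.indicator, Set.mem_preimage, Pi.one_apply]

/-- The total masses of the curve measure and of the SAW measure agree. [folklore] -/
theorem edgeFugacityCurveWeight_univ (emb : V → ℂ) (y : V → V → ℝ) (δ : ℝ) :
    edgeFugacityCurveWeight G emb y S δ a b Set.univ = edgeFugacityWeight G y S a b Set.univ := by
  rw [edgeFugacityCurveWeight_eq_map,
    Measure.map_apply (RestrictedSAW.measurable_of_top _) MeasurableSet.univ, Set.preimage_univ]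

/-- **The curve law is the push-forward of the SAW law along `curve`** — so the inline object of
the route items is the law of the curve drawn by a SAW sampled from `edgeFugacityLaw`.
[folklore] -/
theorem edgeFugacityCurveLaw_eq_map (emb : V → ℂ) (y : V → V → ℝ) (δ : ℝ) :
    edgeFugacityCurveLaw G emb y S δ a b =
      (edgeFugacityLaw G y S a b).map (RestrictedSAW.curve emb δ) := by
  rw [edgeFugacityCurveLaw, edgeFugacityLaw, Measure.map_smul, edgeFugacityCurveWeight_univ,
    edgeFugacityCurveWeight_eq_map]

/-- The observable `γ ↦ γ.curve` is measurable for the law (discrete σ-algebra). [folklore] -/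
theorem aemeasurable_restrictedSAW_curve (emb : V → ℂ) (y : V → V → ℝ) (δ : ℝ) :
    AEMeasurable (RestrictedSAW.curve (G := G) (S := S) (a := a) (b := b) emb δ)
      (edgeFugacityLaw G y S a b) :=
  (RestrictedSAW.measurable_of_top _).aemeasurable

/-! ### Single fugacity: `embWeight` / `embLaw` of `HexSAW.lean` -/

section SingleFugacity

variable {G₀ : SimpleGraph V} {emb : V → ℂ} {Ω : Set ℂ} {δ : ℝ} {a b : V}

/-- The SAWs of the discrete domain `Ω_δ` (`EmbDomainSAW`, a structure `(walk, isPath)` over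
`embDomainGraph G₀ emb Ω δ`) are the SAWs of that graph through `univ`. [folklore] -/
def EmbDomainSAW.equivRestrictedSAW :
    EmbDomainSAW G₀ emb Ω δ a b ≃ RestrictedSAW (embDomainGraph G₀ emb Ω δ) Set.univ a b where
  toFun γ := ⟨γ.walk, γ.isPath, fun _ _ ↦ Set.mem_univ _⟩
  invFun γ := ⟨γ.walk, γ.isPath⟩
  left_inv γ := by cases γ; rfl
  right_inv γ := by rfl

/-- The equivalence preserves the drawn curve. [folklore] -/
@[simp] theorem EmbDomainSAW.curve_equivRestrictedSAW (γ : EmbDomainSAW G₀ emb Ω δ a b) :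
    (EmbDomainSAW.equivRestrictedSAW γ).curve emb δ = γ.curve := rfl

/-- **`x^{ℓ(γ)} = x · x^{#edges}`**: along the equivalence, Duminil-Copin–Smirnov's weight by the
number `ℓ(γ) = #edges + 1` of VISITED VERTICES is `x` times the edge-fugacity weight with `y ≡ x`
(`x ≥ 0`). [cite: DuminilCopinSmirnov2012, §1 and §4] [cite: GrimmettLi2019, §2, (2.2)] -/
theorem map_embWeight_eq {x : ℝ} (hx : 0 ≤ x) :
    (embWeight G₀ emb Ω δ x a b).map EmbDomainSAW.equivRestrictedSAW =
      ENNReal.ofReal x •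
        edgeFugacityWeight (embDomainGraph G₀ emb Ω δ) (fun _ _ ↦ x) Set.univ a b := by
  set e := (EmbDomainSAW.equivRestrictedSAW : EmbDomainSAW G₀ emb Ω δ a b ≃ _) with he
  have hm : Measurable e := EmbDomainSAW.measurable_of_top _
  ext A hA
  rw [Measure.map_apply hm hA, embWeight, Measure.sum_apply _ (hm hA), Measure.smul_apply,
    edgeFugacityWeight, Measure.sum_apply _ hA, smul_eq_mul, ← ENNReal.tsum_mul_left]
  -- reindex the sum along the equivalence
  rw [← e.tsum_eq]
  refine tsum_congr fun γ ↦ ?_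
  classical
  simp only [Measure.smul_apply, smul_eq_mul, Measure.dirac_apply' _ hA,
    Measure.dirac_apply' _ (hm hA), Set.indicator, Set.mem_preimage, Pi.one_apply]
  split_ifs with h
  · have hwalk : (e γ).walk = γ.walk := rfl
    rw [hwalk, dartWeight_const, mul_one, mul_one, ← ENNReal.ofReal_mul hx]
    congr 1
    rw [EmbDomainSAW.vertexCount, EmbDomainSAW.length, pow_succ, mul_comm]
  · simp

/-- **Single-fugacity specialisation of the law**: for `x > 0`, the law `P_{x,δ}` of
`HexSAW.lean` (`embLaw`, weight `x^{#vertices}`) is carried by the equivalence to the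
edge-fugacity law with constant weight `y ≡ x` (weight `x^{#edges}`): the extra factor `x`
cancels on normalisation. [cite: DuminilCopinSmirnov2012, §4 (before Conjecture 1)]
[cite: GrimmettLi2019, §2, (2.2)] -/
theorem map_embLaw_eq {x : ℝ} (hx : 0 < x) :
    (embLaw G₀ emb Ω δ x a b).map EmbDomainSAW.equivRestrictedSAW =
      edgeFugacityLaw (embDomainGraph G₀ emb Ω δ) (fun _ _ ↦ x) Set.univ a b := by
  set w := edgeFugacityWeight (embDomainGraph G₀ emb Ω δ) (fun _ _ ↦ x) Set.univ a b with hw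
  have hm : Measurable (EmbDomainSAW.equivRestrictedSAW : EmbDomainSAW G₀ emb Ω δ a b ≃ _) :=
    EmbDomainSAW.measurable_of_top _
  have hx0 : ENNReal.ofReal x ≠ 0 := by simpa using hx
  have huniv : embWeight G₀ emb Ω δ x a b Set.univ = ENNReal.ofReal x * w Set.univ := by
    have := congrArg (fun μ : Measure _ ↦ μ Set.univ) (map_embWeight_eq (G₀ := G₀) (emb := emb)
      (Ω := Ω) (δ := δ) (a := a) (b := b) hx.le)
    simp only [Measure.map_apply hm MeasurableSet.univ, Set.preimage_univ, Measure.smul_apply,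
      smul_eq_mul] at this
    exact this
  rw [embLaw, Measure.map_smul, map_embWeight_eq hx.le, huniv, edgeFugacityLaw, ← hw, smul_smul]
  congr 1
  rw [ENNReal.mul_inv (Or.inl hx0) (Or.inl ENNReal.ofReal_ne_top), mul_comm (ENNReal.ofReal x)⁻¹,
    mul_assoc, ENNReal.inv_mul_cancel hx0 ENNReal.ofReal_ne_top, mul_one]

end SingleFugacity

end Literature.Probability.RandomPlanarGeometry.SAW

end
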